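/-
Copyright (c) 2026 the pub-hodgecm-mathlib formalisation cell (harness21).  Prover seat hodgecm-mathlib-K2E1-p09 (g5), Track B ∕ K2-LIT,
h413 = `stmt-HodgeConjecture-24833`, line `K2_E1_TraceFormulaBeta`, campaign «EIS-RANK-ONE»; deal «MS-PAIR-2» of the dealer K2E1-plan (g4) 2026-09-04T06:39:24Z ∕ 06:58:54Z (3):
«CM-FINAL-2» ED. 2 = ED. «two_pair» (the four absolute convergences PROVED by ★ p858184) at the CM pair — the `U(J₂)` twin of ★ p858111 `maassSelberg_flatSectionU_cm_three_final′`.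
-/
import Summits.HodgeConjecture.HodgeConjecture.Theorems.K2E1MaassSelbergCMTwoFinalArch      -- ★ p858132 (this seat): imports ★ p858104 «CM-FINAL-2» ED. 1 (§1–§3) and ★ p857911 B′ ∕ ★ p858035
import Summits.HodgeConjecture.HodgeConjecture.Theorems.K2E1MaassSelbergCMTwoPairingsFin    -- ★ p858184 (this seat): ED. «two_pair» `maassSelberg_flatSectionU_two_pair` — `hψL1 hi₅ habs habs′` PROVED
import HarnessLib

/-!
# K2·E1 — `K2E1MaassSelbergCMTwoFinalPair`: THE MAASS–SELBERG RELATION FOR FLAT SECTIONS OF `U(J₂)` AT THE CM PAIR WITH THE FOUR ABSOLUTE CONVERGENCES PROVED («CM-FINAL-2» ED. 2)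
# (campaign «EIS-RANK-ONE», «MS-PAIR-2» (i)+(ii) assembled: ★ p858184 ED. «two_pair» at `(L⁺, L, conj)` with every structural ∕ Godement input discharged by name)

Track B ∕ K2-LIT, crux h413 = `stmt-HodgeConjecture-24833`, route of record `HCCMUnconditional`; cell `hodgecm-mathlib`, squad K2, ENGINE E1.  Prover seat `hodgecm-mathlib-K2E1-p09` (g5).
THEOREMS ONLY (no `def`, no `instance`, no notation, no named-fact hypothesis, no `sorry`); lane `--supports stmt-HodgeConjecture-24833 --as helper` (count-neutral).  Closes no socket.

THE MATHEMATICS [MoeglinWaldspurger1995, II.1.5–II.1.7, IV.2.1–IV.2.3; Arthur1980TraceFormulaII, §4; Garrett2018, §11.3].  ★ p858104 «CM-FINAL-2» ED. 1 named the four absolute convergences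
`hψL1 hi₅ habs habs′`; ★ p858154 ∕ ★ p858184 («MS-FIN-2»_two FILES A–B) PROVE them on the sub-tube `1 < Re z′ < Re z` by height-only majorants (`2ρ_H = 1`: exponents `(Re z;≤)(1−Re z;>)`,
`(1−Re z′+Re z;≤)(2−Re z−Re z′;>)`, `(Re z′+1−Re z;>)`), Tate at the cut-off, and ★ [D8]_two.  This file re-runs the three CM discharges of ★ p858104 ∕ ★ p858132 over ★ ED. «two_pair»
instead of ★ `_two_fin`:
§1 **`maassSelberg_flatSectionU_cm_two_final′`** — survivors EXACTLY `hdec′` (decay of `E(f′_{z′}) − E(f′_{z′})_B` on `{H > T}`) and the `K_U`-average data `hΞ₁…hΞ₄` (the consumer's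
torus-character datum); `hfinz hfinz′ hint′ hsum hΛm hΛG hΛbdd hc hc1 hBK [ν.IsInvInvariant]` discharged as in ED. 1.
§2 **`maassSelberg_flatSectionU_cm_two_final_const′`** — SPHERICAL second section `f′_{z′} = φ₀′·H^{z′}`: survivors EXACTLY the modularity `hf′` (unitary Hecke `χ`; ★ p858035 [D5] ∘ ★ p857911 B′
pay `hdec′`, their auxiliary `δ`, Haar measures, Borel structures, `m`, `hij hN` chosen inside) and `hΞ₁…hΞ₄`.
§3 **`maassSelberg_flatSectionU_cm_two_final_of_archSmooth′`** — GENERAL finite-level `φ′`: survivors `χ hχ hf′ U₀ hU₀o hU₀K hφ′U m hm A_φ′ hA_φ′ hφ′arch` (★ p857911 B′ pays `hdec′`) and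
`hΞ₁…hΞ₄`.
Structural datum `(ν, 𝓕)` and idele class domain: ★ p858104 `exists_unipotent_binders_cm_two`; level binders: ★ p857911 `exists_level_binders_cm_two`.
HONEST LABEL: HC_CM is proved only modulo the 7 printed citations (2 remaining named inputs: hLiu418 = `stmt-HodgeConjecture-24832`, h413 = `stmt-HodgeConjecture-24833`) until rung 0
closes; this file asserts no named fact and closes no socket; `[ν_G.IsInvInvariant]` (unimodularity of `U(J₂)(𝔸)`) and the automorphic measure `μ` stay binders of the statement.
References: [MoeglinWaldspurger1995] I.2.10–I.2.13, II.1.5–II.1.7, IV.2.1–IV.2.3 · [Arthur1980TraceFormulaII] §4 · [Garrett2018] §2.8–§2.11, §11.3 · [Godement1964] §8 · [Rogawski1990] §2.2.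
-/

set_option autoImplicit false
-- the mandated namespace repeats the single-problem summit's segment (`HodgeConjecture.HodgeConjecture`)
set_option linter.dupNamespace false

noncomputable section

open MeasureTheory Measure NumberField IsDedekindDomain Set MulAction Filter Topology Module
open scoped ENNReal NNReal ComplexConjugate Classical
open Literature.MeasureTheory.Group Literature.NumberTheory
open Literature.NumberTheory.Automorphic Literature.NumberTheory.Automorphic.UnitaryGroup AdelicGroupData
open NumberField.mixedEmbedding
open Summit.HodgeConjecture.HodgeConjecture.Cruxes.H413.K2E1BorelEisensteinU
open Summit.HodgeConjecture.HodgeConjecture.Cruxes.H413.K2E1MaassSelbergBracketsThree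
open Summit.HodgeConjecture.HodgeConjecture.Cruxes.H413.K2E1MaassSelbergCMTwo (summable_flatSectionU_cm_two)
open Summit.HodgeConjecture.HodgeConjecture.Cruxes.H413.K2E1MaassSelbergCMTwoPairingsFin (maassSelberg_flatSectionU_two_pair)
open Summit.HodgeConjecture.HodgeConjecture.Cruxes.H413.K2E1TruncatedEisensteinBoundedCMTwo
open Summit.HodgeConjecture.HodgeConjecture.Cruxes.H413.K2E1TruncatedEisensteinBoundedCMThree (truncation_eisensteinSeriesU_flatSectionU_arithmeticSubgroup_mul)
open Summit.HodgeConjecture.HodgeConjecture.Cruxes.H413.K2E1EisensteinAnalyticBinders (hfin_of_locallyUniformMajorant integrableOn_translate_of_continuous)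
open Summit.HodgeConjecture.HodgeConjecture.Cruxes.H413.K2E1BorelEisensteinGodementCMTwo (exists_locallyUniform_majorant_flatSectionU_cm_two)
open Summit.HodgeConjecture.HodgeConjecture.Cruxes.H413.K2E1BorelEisensteinRegularU (continuous_eisensteinSeriesU_flatSectionU_cm_two)
open Summit.HodgeConjecture.HodgeConjecture.Cruxes.H413.K2E1BorelCosetsDictionary (forall_arithmeticBorel_iff)
open Summit.HodgeConjecture.HodgeConjecture.Cruxes.H413.K2E1UnipotentHaarNormalisationU2 (isInvInvariant_of_isHaarMeasure_two)
open Summit.HodgeConjecture.HodgeConjecture.Cruxes.H413.K2E1HeightLineArchSmoothU2 (exists_bound_sub_borelConstantTerm_level_cm_two_const)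
open Summit.HodgeConjecture.HodgeConjecture.Cruxes.H413.K2E1EisensteinMinusConstantTermBoundedLevelCMTwo (exists_bound_sub_borelConstantTerm_level_cm_two_of_archSmooth)

namespace Summit.HodgeConjecture.HodgeConjecture.Cruxes.H413.K2E1MaassSelbergCMTwoFinalPair

variable (L : Type) [Field L] [NumberField L] [IsCMField L]
  (hij : (((0 : Fin 2) : ℕ)) + 1 = ((1 : Fin 2) : ℕ)) (hN : 2 = 2 * ((0 : Fin 2) : ℕ) + 2)
variable [MeasurableSpace (quasiSplit (↥(maximalRealSubfield L)) L (IsCMField.complexConj L) 2).Adelic] [BorelSpace (quasiSplit (↥(maximalRealSubfield L)) L (IsCMField.complexConj L) 2).Adelic]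
variable [MeasurableSpace (AdeleRing (𝓞 L) L)ˣ] [BorelSpace (AdeleRing (𝓞 L) L)ˣ]

/-! ## §1 ED. 2: survivors `hdec′` and `hΞ₁…hΞ₄` -/

/-- **THE MAASS–SELBERG RELATION FOR FLAT SECTIONS OF `U(J₂)` AT THE CM PAIR, ED. 2** = ★ p858104 `maassSelberg_flatSectionU_cm_two_final` with the four absolute-convergence inputs
`hψL1`, `hi₅`, `habs`, `habs′` DISCHARGED (★ p858184 ED. «two_pair» in place of ★ `_two_fin`; every other discharge as in ED. 1, `[ν.IsInvInvariant]` included).  NAMED INPUTS EXACTLY: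
`hdec′` and the `K_U`-average data `hΞ₁…hΞ₄`; conclusion verbatim ★ [D8]_two's. [cite: MoeglinWaldspurger1995, II.1.5–II.1.7 and IV.2.1–IV.2.3] [cite: Arthur1980TraceFormulaII, §4] [cite: Garrett2018, §11.3] -/
theorem maassSelberg_flatSectionU_cm_two_final'
    (μ : Measure (quasiSplit (↥(maximalRealSubfield L)) L (IsCMField.complexConj L) 2).automorphicQuotient) [(quasiSplit (↥(maximalRealSubfield L)) L (IsCMField.complexConj L) 2).IsAutomorphicMeasure μ]
    (νG : Measure (quasiSplit (↥(maximalRealSubfield L)) L (IsCMField.complexConj L) 2).Adelic) [νG.IsHaarMeasure] [νG.IsInvInvariant]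
    (μK : Measure ((standardMaximalCompactGL 2 L).comap (adelicVal (↥(maximalRealSubfield L)) L (IsCMField.complexConj L) 2 ((StdForm.antidiagonal 2).over L)) : Subgroup (quasiSplit (↥(maximalRealSubfield L)) L (IsCMField.complexConj L) 2).Adelic))
    [μK.IsHaarMeasure]
    (νI : Measure (AdeleRing (𝓞 L) L)ˣ) [νI.IsHaarMeasure]
    {𝓕I : Set (AdeleRing (𝓞 L) L)ˣ} (h𝓕I : IsIdeleClassDomain L 𝓕I)
    (ν : Measure ↥(adelicUnipotent (↥(maximalRealSubfield L)) L (IsCMField.complexConj L) 2)) [ν.IsHaarMeasure]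
    {𝓕 : Set ↥(adelicUnipotent (↥(maximalRealSubfield L)) L (IsCMField.complexConj L) 2)} (h𝓕N : IsFundamentalDomain ↥(rationalUnipotent (↥(maximalRealSubfield L)) L (IsCMField.complexConj L) 2) 𝓕 ν) (h𝓕1 : ν 𝓕 = 1)
    (h𝓕c : IsCompact (closure 𝓕)) :
    ∃ cμ K : ℝ, 0 < cμ ∧ 0 < K ∧
      ∀ {β : (quasiSplit (↥(maximalRealSubfield L)) L (IsCMField.complexConj L) 2).Adelic → ℝ≥0∞}, IsCoveringWeight ((arithmeticBorel (↥(maximalRealSubfield L)) L (IsCMField.complexConj L) 2).map (quasiSplit (↥(maximalRealSubfield L)) L (IsCMField.complexConj L) 2).arithmeticSubgroup.subtype) β →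
      ∀ {T : ℝ≥0}, 1 ≤ T →
      ∀ {φ φ' : (quasiSplit (↥(maximalRealSubfield L)) L (IsCMField.complexConj L) 2).Adelic → ℂ},
      Continuous φ →
        (∀ (n : unipotentInBorel (↥(maximalRealSubfield L)) L (IsCMField.complexConj L) 2) (y : (quasiSplit (↥(maximalRealSubfield L)) L (IsCMField.complexConj L) 2).Adelic), φ (((n : borelAdelic (↥(maximalRealSubfield L)) L (IsCMField.complexConj L) 2) : (quasiSplit (↥(maximalRealSubfield L)) L (IsCMField.complexConj L) 2).Adelic) * y) = φ y) →
        (∀ b ∈ arithmeticBorel (↥(maximalRealSubfield L)) L (IsCMField.complexConj L) 2, ∀ y : (quasiSplit (↥(maximalRealSubfield L)) L (IsCMField.complexConj L) 2).Adelic, φ ((b : (quasiSplit (↥(maximalRealSubfield L)) L (IsCMField.complexConj L) 2).Adelic) * y) = φ y) →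
      ∀ {Cφ : ℝ}, (∀ x, ‖φ x‖ ≤ Cφ) →
      Continuous φ' →
        (∀ (n : unipotentInBorel (↥(maximalRealSubfield L)) L (IsCMField.complexConj L) 2) (y : (quasiSplit (↥(maximalRealSubfield L)) L (IsCMField.complexConj L) 2).Adelic), φ' (((n : borelAdelic (↥(maximalRealSubfield L)) L (IsCMField.complexConj L) 2) : (quasiSplit (↥(maximalRealSubfield L)) L (IsCMField.complexConj L) 2).Adelic) * y) = φ' y) →
        (∀ b ∈ arithmeticBorel (↥(maximalRealSubfield L)) L (IsCMField.complexConj L) 2, ∀ y : (quasiSplit (↥(maximalRealSubfield L)) L (IsCMField.complexConj L) 2).Adelic, φ' ((b : (quasiSplit (↥(maximalRealSubfield L)) L (IsCMField.complexConj L) 2).Adelic) * y) = φ' y) →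
      ∀ {Cφ' : ℝ}, (∀ x, ‖φ' x‖ ≤ Cφ') →
      ∀ {z z' : ℂ}, 1 < z'.re → z'.re < z.re →
      -- NAMED: the decay `hdec′` of `E(f′_{z′}) − E(f′_{z′})_B` on the Siegel region `{H > T}` (⟹ `hΛbdd` via ★ p857723), then the `K_U`-average data `hΞ₁…hΞ₄` — the four absolute convergences are PROVED (★ p858184 `maassSelberg_flatSectionU_two_pair`)
        ∀ {M₁ : ℝ}, (∀ g : (quasiSplit (↥(maximalRealSubfield L)) L (IsCMField.complexConj L) 2).Adelic, T < borelHeight g →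
          ‖eisensteinSeriesU (flatSectionU φ' z') g - borelConstantTerm ν 𝓕 (eisensteinSeriesU (flatSectionU φ' z')) g‖ ≤ M₁) →
      ∀ {Ξ₁ Ξ₂ Ξ₃ Ξ₄ : (AdeleRing (𝓞 L) L)ˣ → ℂ},
      Measurable Ξ₁ → ∀ {CΞ₁ : ℝ}, (∀ x, ‖Ξ₁ x‖ ≤ CΞ₁) → (∀ k ∈ GaloisRepresentations.principalIdeles L, ∀ x, Ξ₁ (k * x) = Ξ₁ x) →
        (∀ (r : ℝ≥0ˣ) (x : (AdeleRing (𝓞 L) L)ˣ), Ξ₁ (posRealIdele L r * x) = Ξ₁ x) →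
        (∀ t : torusInBorel (↥(maximalRealSubfield L)) L (IsCMField.complexConj L) 2,
          ∫ k, φ (((t : borelAdelic (↥(maximalRealSubfield L)) L (IsCMField.complexConj L) 2) : (quasiSplit (↥(maximalRealSubfield L)) L (IsCMField.complexConj L) 2).Adelic) * (k : (quasiSplit (↥(maximalRealSubfield L)) L (IsCMField.complexConj L) 2).Adelic)) *
              conj (φ' (((t : borelAdelic (↥(maximalRealSubfield L)) L (IsCMField.complexConj L) 2) : (quasiSplit (↥(maximalRealSubfield L)) L (IsCMField.complexConj L) 2).Adelic) * (k : (quasiSplit (↥(maximalRealSubfield L)) L (IsCMField.complexConj L) 2).Adelic))) ∂μK = Ξ₁ (diagUnit (t : borelAdelic (↥(maximalRealSubfield L)) L (IsCMField.complexConj L) 2).2 0)) →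
      Measurable Ξ₂ → ∀ {CΞ₂ : ℝ}, (∀ x, ‖Ξ₂ x‖ ≤ CΞ₂) → (∀ k ∈ GaloisRepresentations.principalIdeles L, ∀ x, Ξ₂ (k * x) = Ξ₂ x) →
        (∀ (r : ℝ≥0ˣ) (x : (AdeleRing (𝓞 L) L)ˣ), Ξ₂ (posRealIdele L r * x) = Ξ₂ x) →
        (∀ t : torusInBorel (↥(maximalRealSubfield L)) L (IsCMField.complexConj L) 2,
          ∫ k, φ (((t : borelAdelic (↥(maximalRealSubfield L)) L (IsCMField.complexConj L) 2) : (quasiSplit (↥(maximalRealSubfield L)) L (IsCMField.complexConj L) 2).Adelic) * (k : (quasiSplit (↥(maximalRealSubfield L)) L (IsCMField.complexConj L) 2).Adelic)) *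
              conj ((fun g : (quasiSplit (↥(maximalRealSubfield L)) L (IsCMField.complexConj L) 2).Adelic => (∫ v : ↥(adelicUnipotent (↥(maximalRealSubfield L)) L (IsCMField.complexConj L) 2), flatSectionU φ' z' ((quasiSplit (↥(maximalRealSubfield L)) L (IsCMField.complexConj L) 2).toAdelic (weylLongU ((IsCMField.complexConj L : L ≃ₐ[↥(maximalRealSubfield L)] L) : L →+* L) (rfl : (StdForm.antidiagonal 2).over L = (StdForm.antidiagonal 2).over L)) * ((v : (quasiSplit (↥(maximalRealSubfield L)) L (IsCMField.complexConj L) 2).Adelic) * g)) ∂ν) * ((borelHeight g : ℝ) : ℂ) ^ (z' - 1)) (((t : borelAdelic (↥(maximalRealSubfield L)) L (IsCMField.complexConj L) 2) : (quasiSplit (↥(maximalRealSubfield L)) L (IsCMField.complexConj L) 2).Adelic) * (k : (quasiSplit (↥(maximalRealSubfield L)) L (IsCMField.complexConj L) 2).Adelic))) ∂μK = Ξ₂ (diagUnit (t : borelAdelic (↥(maximalRealSubfield L)) L (IsCMField.complexConj L) 2).2 0)) →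
      Measurable Ξ₃ → ∀ {CΞ₃ : ℝ}, (∀ x, ‖Ξ₃ x‖ ≤ CΞ₃) → (∀ k ∈ GaloisRepresentations.principalIdeles L, ∀ x, Ξ₃ (k * x) = Ξ₃ x) →
        (∀ (r : ℝ≥0ˣ) (x : (AdeleRing (𝓞 L) L)ˣ), Ξ₃ (posRealIdele L r * x) = Ξ₃ x) →
        (∀ t : torusInBorel (↥(maximalRealSubfield L)) L (IsCMField.complexConj L) 2,
          ∫ k, (fun g : (quasiSplit (↥(maximalRealSubfield L)) L (IsCMField.complexConj L) 2).Adelic => (∫ v : ↥(adelicUnipotent (↥(maximalRealSubfield L)) L (IsCMField.complexConj L) 2), flatSectionU φ z ((quasiSplit (↥(maximalRealSubfield L)) L (IsCMField.complexConj L) 2).toAdelic (weylLongU ((IsCMField.complexConj L : L ≃ₐ[↥(maximalRealSubfield L)] L) : L →+* L) (rfl : (StdForm.antidiagonal 2).over L = (StdForm.antidiagonal 2).over L)) * ((v : (quasiSplit (↥(maximalRealSubfield L)) L (IsCMField.complexConj L) 2).Adelic) * g)) ∂ν) * ((borelHeight g : ℝ) : ℂ) ^ (z - 1)) (((t : borelAdelic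 (↥(maximalRealSubfield L)) L (IsCMField.complexConj L) 2) : (quasiSplit (↥(maximalRealSubfield L)) L (IsCMField.complexConj L) 2).Adelic) * (k : (quasiSplit (↥(maximalRealSubfield L)) L (IsCMField.complexConj L) 2).Adelic)) *
              conj (φ' (((t : borelAdelic (↥(maximalRealSubfield L)) L (IsCMField.complexConj L) 2) : (quasiSplit (↥(maximalRealSubfield L)) L (IsCMField.complexConj L) 2).Adelic) * (k : (quasiSplit (↥(maximalRealSubfield L)) L (IsCMField.complexConj L) 2).Adelic))) ∂μK = Ξ₃ (diagUnit (t : borelAdelic (↥(maximalRealSubfield L)) L (IsCMField.complexConj L) 2).2 0)) →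
      Measurable Ξ₄ → ∀ {CΞ₄ : ℝ}, (∀ x, ‖Ξ₄ x‖ ≤ CΞ₄) → (∀ k ∈ GaloisRepresentations.principalIdeles L, ∀ x, Ξ₄ (k * x) = Ξ₄ x) →
        (∀ (r : ℝ≥0ˣ) (x : (AdeleRing (𝓞 L) L)ˣ), Ξ₄ (posRealIdele L r * x) = Ξ₄ x) →
        (∀ t : torusInBorel (↥(maximalRealSubfield L)) L (IsCMField.complexConj L) 2,
          ∫ k, (fun g : (quasiSplit (↥(maximalRealSubfield L)) L (IsCMField.complexConj L) 2).Adelic => (∫ v : ↥(adelicUnipotent (↥(maximalRealSubfield L)) L (IsCMField.complexConj L) 2), flatSectionU φ z ((quasiSplit (↥(maximalRealSubfield L)) L (IsCMField.complexConj L) 2).toAdelic (weylLongU ((IsCMField.complexConj L : L ≃ₐ[↥(maximalRealSubfield L)] L) : L →+* L) (rfl : (StdForm.antidiagonal 2).over L = (StdForm.antidiagonal 2).over L)) * ((v : (quasiSplit (↥(maximalRealSubfield L)) L (IsCMField.complexConj L) 2).Adelic) * g)) ∂ν) * ((borelHeight g : ℝ) : ℂ) ^ (z - 1)) (((t : borelAdelic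 (↥(maximalRealSubfield L)) L (IsCMField.complexConj L) 2) : (quasiSplit (↥(maximalRealSubfield L)) L (IsCMField.complexConj L) 2).Adelic) * (k : (quasiSplit (↥(maximalRealSubfield L)) L (IsCMField.complexConj L) 2).Adelic)) *
              conj ((fun g : (quasiSplit (↥(maximalRealSubfield L)) L (IsCMField.complexConj L) 2).Adelic => (∫ v : ↥(adelicUnipotent (↥(maximalRealSubfield L)) L (IsCMField.complexConj L) 2), flatSectionU φ' z' ((quasiSplit (↥(maximalRealSubfield L)) L (IsCMField.complexConj L) 2).toAdelic (weylLongU ((IsCMField.complexConj L : L ≃ₐ[↥(maximalRealSubfield L)] L) : L →+* L) (rfl : (StdForm.antidiagonal 2).over L = (StdForm.antidiagonal 2).over L)) * ((v : (quasiSplit (↥(maximalRealSubfield L)) L (IsCMField.complexConj L) 2).Adelic) * g)) ∂ν) * ((borelHeight g : ℝ) : ℂ) ^ (z' - 1)) (((t : borelAdelic (↥(maximalRealSubfield L)) L (IsCMField.complexConj L) 2) : (quasiSplit (↥(maximalRealSubfield L)) L (IsCMField.complexConj L) 2).Adelic) * (k : (quasiSplit (↥(maximalRealSubfield L)) L (IsCMField.complexConj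 L) 2).Adelic))) ∂μK = Ξ₄ (diagUnit (t : borelAdelic (↥(maximalRealSubfield L)) L (IsCMField.complexConj L) 2).2 0)) →
        ∫ x, (quasiSplit (↥(maximalRealSubfield L)) L (IsCMField.complexConj L) 2).quotFun (truncation ν 𝓕 T (eisensteinSeriesU (flatSectionU φ z))) x * conj ((quasiSplit (↥(maximalRealSubfield L)) L (IsCMField.complexConj L) 2).quotFun (truncation ν 𝓕 T (eisensteinSeriesU (flatSectionU φ' z'))) x) ∂μ =
          (cμ : ℂ) * ((K : ℂ) *
            ((((T : ℝ) : ℂ) ^ (z + conj z' - 1) / (z + conj z' - 1)) * (∫ x in {x : (AdeleRing (𝓞 L) L)ˣ | (IdeleClassGroup.ideleNorm L x : ℝ) ≤ 1} ∩ 𝓕I, ((IdeleClassGroup.ideleNorm L x : ℝ) : ℂ) * Ξ₁ x ∂νI)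
              + (((T : ℝ) : ℂ) ^ (z - conj z') / (z - conj z')) * (∫ x in {x : (AdeleRing (𝓞 L) L)ˣ | (IdeleClassGroup.ideleNorm L x : ℝ) ≤ 1} ∩ 𝓕I, ((IdeleClassGroup.ideleNorm L x : ℝ) : ℂ) * Ξ₂ x ∂νI)
              - (((T : ℝ) : ℂ) ^ (-(z - conj z')) / (z - conj z')) * (∫ x in {x : (AdeleRing (𝓞 L) L)ˣ | (IdeleClassGroup.ideleNorm L x : ℝ) ≤ 1} ∩ 𝓕I, ((IdeleClassGroup.ideleNorm L x : ℝ) : ℂ) * Ξ₃ x ∂νI)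
              - (((T : ℝ) : ℂ) ^ (-(z + conj z' - 1)) / (z + conj z' - 1)) * (∫ x in {x : (AdeleRing (𝓞 L) L)ˣ | (IdeleClassGroup.ideleNorm L x : ℝ) ≤ 1} ∩ 𝓕I, ((IdeleClassGroup.ideleNorm L x : ℝ) : ℂ) * Ξ₄ x ∂νI))) := by
  haveI := t2Space_adeleRing_of_numberField L
  haveI := locallyCompactSpace_adeleRing' L
  haveI : T2Space (quasiSplit (↥(maximalRealSubfield L)) L (IsCMField.complexConj L) 2).Adelic := inferInstanceAs (T2Space (adelic (↥(maximalRealSubfield L)) L (IsCMField.complexConj L) 2 ((StdForm.antidiagonal 2).over L)))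
  haveI : ν.IsInvInvariant := isInvInvariant_of_isHaarMeasure_two ν
  obtain ⟨cμ, K, hcμ, hK, h7⟩ := maassSelberg_flatSectionU_two_pair (AlgEquiv.ext fun x => IsCMField.complexConj_apply_apply L x) (IsCMField.complexConj_ne_one L) μ νG μK νI
    (exists_mem_borelAdelic_mul_mem_standardMaximalCompactGL_cm L) h𝓕I ν h𝓕N h𝓕1
  refine ⟨cμ, K, hcμ, hK, ?_⟩
  intro β hβ T hT φ φ' hφc hφN hφB Cφ hφC hφ'c hφ'N hφ'B Cφ' hφ'C z z' hz' hzz' M₁ hdec'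
    Ξ₁ Ξ₂ Ξ₃ Ξ₄ hΞ₁m CΞ₁ hΞ₁C hΞ₁K hΞ₁M hΞ₁ hΞ₂m CΞ₂ hΞ₂C hΞ₂K hΞ₂M hΞ₂ hΞ₃m CΞ₃ hΞ₃C hΞ₃K hΞ₃M hΞ₃ hΞ₄m CΞ₄ hΞ₄C hΞ₄K hΞ₄M hΞ₄
  have hz : 1 < z.re := hz'.trans hzz'
  -- the Godement finiteness of the standard sections `H^w`, `Re w > 1`, at every `g` (★ `hfin_of_locallyUniformMajorant` + ★ (G″)_two majorant, `𝓕` of compact closure)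
  have hstdB : ∀ w : ℂ, ∀ b ∈ borelU ((IsCMField.complexConj L : L ≃ₐ[↥(maximalRealSubfield L)] L) : L →+* L) ((StdForm.antidiagonal 2).over L), ∀ x : (quasiSplit (↥(maximalRealSubfield L)) L (IsCMField.complexConj L) 2).Adelic,
      flatSectionU (fun _ : (quasiSplit (↥(maximalRealSubfield L)) L (IsCMField.complexConj L) 2).Adelic => (1 : ℂ)) w ((quasiSplit (↥(maximalRealSubfield L)) L (IsCMField.complexConj L) 2).toAdelic b * x) = flatSectionU (fun _ : (quasiSplit (↥(maximalRealSubfield L)) L (IsCMField.complexConj L) 2).Adelic => (1 : ℂ)) w x :=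
    fun w => forall_arithmeticBorel_iff.1 fun b hb x => by rw [flatSectionU_apply, flatSectionU_apply, K2E1TruncatedEisensteinExplicit.borelHeight_arithmeticBorel_mul hb]
  have hfin : ∀ {w : ℂ}, 1 < w.re → ∀ g : (quasiSplit (↥(maximalRealSubfield L)) L (IsCMField.complexConj L) 2).Adelic, ∫⁻ u in 𝓕, (∑' q : (quasiSplit (↥(maximalRealSubfield L)) L (IsCMField.complexConj L) 2).quotientSubgroup ⧸ (borelAdelic (↥(maximalRealSubfield L)) L (IsCMField.complexConj L) 2).subgroupOf (quasiSplit (↥(maximalRealSubfield L)) L (IsCMField.complexConj L) 2).quotientSubgroup,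
      ‖flatSectionU (fun _ : (quasiSplit (↥(maximalRealSubfield L)) L (IsCMField.complexConj L) 2).Adelic => (1 : ℂ)) w ((((q.out : (quasiSplit (↥(maximalRealSubfield L)) L (IsCMField.complexConj L) 2).quotientSubgroup) : (quasiSplit (↥(maximalRealSubfield L)) L (IsCMField.complexConj L) 2).Adelic))⁻¹ * (u : (quasiSplit (↥(maximalRealSubfield L)) L (IsCMField.complexConj L) 2).Adelic) * g)‖ₑ) ∂ν < ∞ :=
    fun {w} hw g => hfin_of_locallyUniformMajorant ν (hstdB w) (fun q => (continuous_flatSectionU continuous_const w).comp (continuous_const.mul continuous_id))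
      (exists_locallyUniform_majorant_flatSectionU_cm_two L hw (φ := fun _ : (quasiSplit (↥(maximalRealSubfield L)) L (IsCMField.complexConj L) 2).Adelic => (1 : ℂ)) (M := 1) (fun x => by rw [norm_one])) h𝓕c g
  -- `Λ′`: Borel, `G(L⁺)`-invariant, bounded modulo `hdec′` (★ p857723)
  obtain ⟨M₀, hΛbdd⟩ := exists_norm_truncation_eisensteinSeriesU_flatSectionU_le_cm_two L ν h𝓕N hT hz' hφ'c hφ'C (forall_arithmeticBorel_iff.1 hφ'B) hdec'
  exact h7 hβ hT hφc.measurable hφN hφB hφC hφ'c.measurable hφ'N hφ'B hφ'C hz' hzz' (hfin hz) (hfin hz') (fun g => summable_flatSectionU_cm_two L hz hφC g)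
    (measurable_truncation_eisensteinSeriesU_flatSectionU_cm_two' L ν 𝓕 hT hz' hφ'c hφ'C)
    (truncation_eisensteinSeriesU_flatSectionU_arithmeticSubgroup_mul ν h𝓕N T (forall_arithmeticBorel_iff.1 hφ'B) z') hΛbdd
    (fun g => integrableOn_translate_of_continuous (adelicUnipotent (↥(maximalRealSubfield L)) L (IsCMField.complexConj L) 2) ν
      (continuous_eisensteinSeriesU_flatSectionU_cm_two L hz' hφ'c hφ'C) h𝓕c g)
    hΞ₁m hΞ₁C hΞ₁K hΞ₁M hΞ₁ hΞ₂m hΞ₂C hΞ₂K hΞ₂M hΞ₂ hΞ₃m hΞ₃C hΞ₃K hΞ₃M hΞ₃ hΞ₄m hΞ₄C hΞ₄K hΞ₄M hΞ₄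

/-! ## §2 ED. 2, spherical second section: survivors `hf′` and `hΞ₁…hΞ₄` -/

/-- **ED. 2 WITH SPHERICAL SECOND SECTION `f′_{z′} = φ₀′·H^{z′}`**: survivors EXACTLY the modularity `hf′` of `f′_{z′}` under `B(𝔸)` (unitary Hecke character `χ`, forcing `χ = 1` unless
`φ₀′ = 0`) and `hΞ₁…hΞ₄` — §1 ∘ ★ p858035 `exists_bound_sub_borelConstantTerm_level_cm_two_const` (auxiliary data chosen inside, as in ★ p858104 §2).
[cite: MoeglinWaldspurger1995, I.2.10–I.2.12, II.1.7 and IV.2.1–IV.2.3] [cite: Garrett2018, §2.9 and §11.3] -/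
theorem maassSelberg_flatSectionU_cm_two_final_const'
    (μ : Measure (quasiSplit (↥(maximalRealSubfield L)) L (IsCMField.complexConj L) 2).automorphicQuotient) [(quasiSplit (↥(maximalRealSubfield L)) L (IsCMField.complexConj L) 2).IsAutomorphicMeasure μ]
    (νG : Measure (quasiSplit (↥(maximalRealSubfield L)) L (IsCMField.complexConj L) 2).Adelic) [νG.IsHaarMeasure] [νG.IsInvInvariant]
    (μK : Measure ((standardMaximalCompactGL 2 L).comap (adelicVal (↥(maximalRealSubfield L)) L (IsCMField.complexConj L) 2 ((StdForm.antidiagonal 2).over L)) : Subgroup (quasiSplit (↥(maximalRealSubfield L)) L (IsCMField.complexConj L) 2).Adelic))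
    [μK.IsHaarMeasure]
    (νI : Measure (AdeleRing (𝓞 L) L)ˣ) [νI.IsHaarMeasure]
    {𝓕I : Set (AdeleRing (𝓞 L) L)ˣ} (h𝓕I : IsIdeleClassDomain L 𝓕I)
    (ν : Measure ↥(adelicUnipotent (↥(maximalRealSubfield L)) L (IsCMField.complexConj L) 2)) [ν.IsHaarMeasure]
    {𝓕 : Set ↥(adelicUnipotent (↥(maximalRealSubfield L)) L (IsCMField.complexConj L) 2)} (h𝓕N : IsFundamentalDomain ↥(rationalUnipotent (↥(maximalRealSubfield L)) L (IsCMField.complexConj L) 2) 𝓕 ν) (h𝓕1 : ν 𝓕 = 1)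
    (h𝓕c : IsCompact (closure 𝓕)) :
    ∃ cμ K : ℝ, 0 < cμ ∧ 0 < K ∧
      ∀ {β : (quasiSplit (↥(maximalRealSubfield L)) L (IsCMField.complexConj L) 2).Adelic → ℝ≥0∞}, IsCoveringWeight ((arithmeticBorel (↥(maximalRealSubfield L)) L (IsCMField.complexConj L) 2).map (quasiSplit (↥(maximalRealSubfield L)) L (IsCMField.complexConj L) 2).arithmeticSubgroup.subtype) β →
      ∀ {T : ℝ≥0}, 1 ≤ T →
      ∀ {φ : (quasiSplit (↥(maximalRealSubfield L)) L (IsCMField.complexConj L) 2).Adelic → ℂ}, ∀ (φ₀' : ℂ),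
      Continuous φ →
        (∀ (n : unipotentInBorel (↥(maximalRealSubfield L)) L (IsCMField.complexConj L) 2) (y : (quasiSplit (↥(maximalRealSubfield L)) L (IsCMField.complexConj L) 2).Adelic), φ (((n : borelAdelic (↥(maximalRealSubfield L)) L (IsCMField.complexConj L) 2) : (quasiSplit (↥(maximalRealSubfield L)) L (IsCMField.complexConj L) 2).Adelic) * y) = φ y) →
        (∀ b ∈ arithmeticBorel (↥(maximalRealSubfield L)) L (IsCMField.complexConj L) 2, ∀ y : (quasiSplit (↥(maximalRealSubfield L)) L (IsCMField.complexConj L) 2).Adelic, φ ((b : (quasiSplit (↥(maximalRealSubfield L)) L (IsCMField.complexConj L) 2).Adelic) * y) = φ y) →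
      ∀ {Cφ : ℝ}, (∀ x, ‖φ x‖ ≤ Cφ) →
      ∀ {z z' : ℂ}, 1 < z'.re → z'.re < z.re →
      -- the SPHERICAL `f′_{z′} = φ₀′·H^{z′}`: `hdec′` is ★ p858035 ∘ ★ p857911 B′ modulo the modularity `hf′` (unitary Hecke character `χ`); then the `K_U`-average data `hΞ₁…hΞ₄`
        ∀ (χ : GaloisRepresentations.HeckeCharacter L), χ.IsUnitary →
        (∀ (b g : (quasiSplit (↥(maximalRealSubfield L)) L (IsCMField.complexConj L) 2).Adelic) (u : (AdeleRing (𝓞 L) L)ˣ),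
          ((b.1 : GL (Fin 2) (AdeleRing (𝓞 L) L)) : Matrix (Fin 2) (Fin 2) (AdeleRing (𝓞 L) L)) 1 0 = 0 →
          (u : (AdeleRing (𝓞 L) L)) = ((b.1 : GL (Fin 2) (AdeleRing (𝓞 L) L)) : Matrix (Fin 2) (Fin 2) (AdeleRing (𝓞 L) L)) 0 0 →
            flatSectionU (fun _ : (quasiSplit (↥(maximalRealSubfield L)) L (IsCMField.complexConj L) 2).Adelic => φ₀') z' (b * g) = ((χ u : ℂˣ) : ℂ) * ((GaloisRepresentations.ideleNorm u : ℝ) : ℂ) ^ z' * flatSectionU (fun _ : (quasiSplit (↥(maximalRealSubfield L)) L (IsCMField.complexConj L) 2).Adelic => φ₀') z' g) →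
      ∀ {Ξ₁ Ξ₂ Ξ₃ Ξ₄ : (AdeleRing (𝓞 L) L)ˣ → ℂ},
      Measurable Ξ₁ → ∀ {CΞ₁ : ℝ}, (∀ x, ‖Ξ₁ x‖ ≤ CΞ₁) → (∀ k ∈ GaloisRepresentations.principalIdeles L, ∀ x, Ξ₁ (k * x) = Ξ₁ x) →
        (∀ (r : ℝ≥0ˣ) (x : (AdeleRing (𝓞 L) L)ˣ), Ξ₁ (posRealIdele L r * x) = Ξ₁ x) →
        (∀ t : torusInBorel (↥(maximalRealSubfield L)) L (IsCMField.complexConj L) 2,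
          ∫ k, φ (((t : borelAdelic (↥(maximalRealSubfield L)) L (IsCMField.complexConj L) 2) : (quasiSplit (↥(maximalRealSubfield L)) L (IsCMField.complexConj L) 2).Adelic) * (k : (quasiSplit (↥(maximalRealSubfield L)) L (IsCMField.complexConj L) 2).Adelic)) *
              conj ((fun _ : (quasiSplit (↥(maximalRealSubfield L)) L (IsCMField.complexConj L) 2).Adelic => φ₀') (((t : borelAdelic (↥(maximalRealSubfield L)) L (IsCMField.complexConj L) 2) : (quasiSplit (↥(maximalRealSubfield L)) L (IsCMField.complexConj L) 2).Adelic) * (k : (quasiSplit (↥(maximalRealSubfield L)) L (IsCMField.complexConj L) 2).Adelic))) ∂μK = Ξ₁ (diagUnit (t : borelAdelic (↥(maximalRealSubfield L)) L (IsCMField.complexConj L) 2).2 0)) →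
      Measurable Ξ₂ → ∀ {CΞ₂ : ℝ}, (∀ x, ‖Ξ₂ x‖ ≤ CΞ₂) → (∀ k ∈ GaloisRepresentations.principalIdeles L, ∀ x, Ξ₂ (k * x) = Ξ₂ x) →
        (∀ (r : ℝ≥0ˣ) (x : (AdeleRing (𝓞 L) L)ˣ), Ξ₂ (posRealIdele L r * x) = Ξ₂ x) →
        (∀ t : torusInBorel (↥(maximalRealSubfield L)) L (IsCMField.complexConj L) 2,
          ∫ k, φ (((t : borelAdelic (↥(maximalRealSubfield L)) L (IsCMField.complexConj L) 2) : (quasiSplit (↥(maximalRealSubfield L)) L (IsCMField.complexConj L) 2).Adelic) * (k : (quasiSplit (↥(maximalRealSubfield L)) L (IsCMField.complexConj L) 2).Adelic)) *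
              conj ((fun g : (quasiSplit (↥(maximalRealSubfield L)) L (IsCMField.complexConj L) 2).Adelic => (∫ v : ↥(adelicUnipotent (↥(maximalRealSubfield L)) L (IsCMField.complexConj L) 2), flatSectionU (fun _ : (quasiSplit (↥(maximalRealSubfield L)) L (IsCMField.complexConj L) 2).Adelic => φ₀') z' ((quasiSplit (↥(maximalRealSubfield L)) L (IsCMField.complexConj L) 2).toAdelic (weylLongU ((IsCMField.complexConj L : L ≃ₐ[↥(maximalRealSubfield L)] L) : L →+* L) (rfl : (StdForm.antidiagonal 2).over L = (StdForm.antidiagonal 2).over L)) * ((v : (quasiSplit (↥(maximalRealSubfield L)) L (IsCMField.complexConj L) 2).Adelic) * g)) ∂ν) * ((borelHeight g : ℝ) : ℂ) ^ (z' - 1)) (((t : borelAdelic (↥(maximalRealSubfield L)) L (IsCMField.complexConj L) 2) : (quasiSplit (↥(maximalRealSubfield L)) L (IsCMField.complexConj L) 2).Adelic) * (k : (quasiSplit (↥(maximalRealSubfield L)) L (IsCMField.complexConj L) 2).Adelic))) ∂μK = Ξ₂ (diagUnit (t : borelAdelic (↥(maximalRealSubfield L)) L (IsCMField.complexConj L)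 2).2 0)) →
      Measurable Ξ₃ → ∀ {CΞ₃ : ℝ}, (∀ x, ‖Ξ₃ x‖ ≤ CΞ₃) → (∀ k ∈ GaloisRepresentations.principalIdeles L, ∀ x, Ξ₃ (k * x) = Ξ₃ x) →
        (∀ (r : ℝ≥0ˣ) (x : (AdeleRing (𝓞 L) L)ˣ), Ξ₃ (posRealIdele L r * x) = Ξ₃ x) →
        (∀ t : torusInBorel (↥(maximalRealSubfield L)) L (IsCMField.complexConj L) 2,
          ∫ k, (fun g : (quasiSplit (↥(maximalRealSubfield L)) L (IsCMField.complexConj L) 2).Adelic => (∫ v : ↥(adelicUnipotent (↥(maximalRealSubfield L)) L (IsCMField.complexConj L) 2), flatSectionU φ z ((quasiSplit (↥(maximalRealSubfield L)) L (IsCMField.complexConj L) 2).toAdelic (weylLongU ((IsCMField.complexConj L : L ≃ₐ[↥(maximalRealSubfield L)] L) : L →+* L) (rfl : (StdForm.antidiagonal 2).over L = (StdForm.antidiagonal 2).over L)) * ((v : (quasiSplit (↥(maximalRealSubfield L)) L (IsCMField.complexConj L) 2).Adelic) * g)) ∂ν) * ((borelHeight g : ℝ) : ℂ) ^ (z - 1))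 (((t : borelAdelic (↥(maximalRealSubfield L)) L (IsCMField.complexConj L) 2) : (quasiSplit (↥(maximalRealSubfield L)) L (IsCMField.complexConj L) 2).Adelic) * (k : (quasiSplit (↥(maximalRealSubfield L)) L (IsCMField.complexConj L) 2).Adelic)) *
              conj ((fun _ : (quasiSplit (↥(maximalRealSubfield L)) L (IsCMField.complexConj L) 2).Adelic => φ₀') (((t : borelAdelic (↥(maximalRealSubfield L)) L (IsCMField.complexConj L) 2) : (quasiSplit (↥(maximalRealSubfield L)) L (IsCMField.complexConj L) 2).Adelic) * (k : (quasiSplit (↥(maximalRealSubfield L)) L (IsCMField.complexConj L) 2).Adelic))) ∂μK = Ξ₃ (diagUnit (t : borelAdelic (↥(maximalRealSubfield L)) L (IsCMField.complexConj L) 2).2 0)) →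
      Measurable Ξ₄ → ∀ {CΞ₄ : ℝ}, (∀ x, ‖Ξ₄ x‖ ≤ CΞ₄) → (∀ k ∈ GaloisRepresentations.principalIdeles L, ∀ x, Ξ₄ (k * x) = Ξ₄ x) →
        (∀ (r : ℝ≥0ˣ) (x : (AdeleRing (𝓞 L) L)ˣ), Ξ₄ (posRealIdele L r * x) = Ξ₄ x) →
        (∀ t : torusInBorel (↥(maximalRealSubfield L)) L (IsCMField.complexConj L) 2,
          ∫ k, (fun g : (quasiSplit (↥(maximalRealSubfield L)) L (IsCMField.complexConj L) 2).Adelic => (∫ v : ↥(adelicUnipotent (↥(maximalRealSubfield L)) L (IsCMField.complexConj L) 2), flatSectionU φ z ((quasiSplit (↥(maximalRealSubfield L)) L (IsCMField.complexConj L) 2).toAdelic (weylLongU ((IsCMField.complexConj L : L ≃ₐ[↥(maximalRealSubfield L)] L) : L →+* L) (rfl : (StdForm.antidiagonal 2).over L = (StdForm.antidiagonal 2).over L)) * ((v : (quasiSplit (↥(maximalRealSubfield L)) L (IsCMField.complexConj L) 2).Adelic) * g)) ∂ν) * ((borelHeight g : ℝ) : ℂ) ^ (z - 1)) (((t : borelAdelic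 (↥(maximalRealSubfield L)) L (IsCMField.complexConj L) 2) : (quasiSplit (↥(maximalRealSubfield L)) L (IsCMField.complexConj L) 2).Adelic) * (k : (quasiSplit (↥(maximalRealSubfield L)) L (IsCMField.complexConj L) 2).Adelic)) *
              conj ((fun g : (quasiSplit (↥(maximalRealSubfield L)) L (IsCMField.complexConj L) 2).Adelic => (∫ v : ↥(adelicUnipotent (↥(maximalRealSubfield L)) L (IsCMField.complexConj L) 2), flatSectionU (fun _ : (quasiSplit (↥(maximalRealSubfield L)) L (IsCMField.complexConj L) 2).Adelic => φ₀') z' ((quasiSplit (↥(maximalRealSubfield L)) L (IsCMField.complexConj L) 2).toAdelic (weylLongU ((IsCMField.complexConj L : L ≃ₐ[↥(maximalRealSubfield L)] L) : L →+* L) (rfl : (StdForm.antidiagonal 2).over L = (StdForm.antidiagonal 2).over L)) * ((v : (quasiSplit (↥(maximalRealSubfield L)) L (IsCMField.complexConj L) 2).Adelic) * g)) ∂ν) * ((borelHeight g : ℝ) : ℂ) ^ (z' - 1)) (((t : borelAdelic (↥(maximalRealSubfield L)) L (IsCMField.complexConj L) 2) : (quasiSplit (↥(maximalRealSubfield L))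 L (IsCMField.complexConj L) 2).Adelic) * (k : (quasiSplit (↥(maximalRealSubfield L)) L (IsCMField.complexConj L) 2).Adelic))) ∂μK = Ξ₄ (diagUnit (t : borelAdelic (↥(maximalRealSubfield L)) L (IsCMField.complexConj L) 2).2 0)) →
        ∫ x, (quasiSplit (↥(maximalRealSubfield L)) L (IsCMField.complexConj L) 2).quotFun (truncation ν 𝓕 T (eisensteinSeriesU (flatSectionU φ z))) x * conj ((quasiSplit (↥(maximalRealSubfield L)) L (IsCMField.complexConj L) 2).quotFun (truncation ν 𝓕 T (eisensteinSeriesU (flatSectionU (fun _ : (quasiSplit (↥(maximalRealSubfield L)) L (IsCMField.complexConj L) 2).Adelic => φ₀') z'))) x) ∂μ =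
          (cμ : ℂ) * ((K : ℂ) *
            ((((T : ℝ) : ℂ) ^ (z + conj z' - 1) / (z + conj z' - 1)) * (∫ x in {x : (AdeleRing (𝓞 L) L)ˣ | (IdeleClassGroup.ideleNorm L x : ℝ) ≤ 1} ∩ 𝓕I, ((IdeleClassGroup.ideleNorm L x : ℝ) : ℂ) * Ξ₁ x ∂νI)
              + (((T : ℝ) : ℂ) ^ (z - conj z') / (z - conj z')) * (∫ x in {x : (AdeleRing (𝓞 L) L)ˣ | (IdeleClassGroup.ideleNorm L x : ℝ) ≤ 1} ∩ 𝓕I, ((IdeleClassGroup.ideleNorm L x : ℝ) : ℂ) * Ξ₂ x ∂νI)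
              - (((T : ℝ) : ℂ) ^ (-(z - conj z')) / (z - conj z')) * (∫ x in {x : (AdeleRing (𝓞 L) L)ˣ | (IdeleClassGroup.ideleNorm L x : ℝ) ≤ 1} ∩ 𝓕I, ((IdeleClassGroup.ideleNorm L x : ℝ) : ℂ) * Ξ₃ x ∂νI)
              - (((T : ℝ) : ℂ) ^ (-(z + conj z' - 1)) / (z + conj z' - 1)) * (∫ x in {x : (AdeleRing (𝓞 L) L)ˣ | (IdeleClassGroup.ideleNorm L x : ℝ) ≤ 1} ∩ 𝓕I, ((IdeleClassGroup.ideleNorm L x : ℝ) : ℂ) * Ξ₄ x ∂νI))) := by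
  obtain ⟨cμ, K, hcμ, hK, h⟩ := maassSelberg_flatSectionU_cm_two_final' L μ νG μK νI h𝓕I ν h𝓕N h𝓕1 h𝓕c
  refine ⟨cμ, K, hcμ, hK, ?_⟩
  intro β hβ T hT φ φ₀' hφc hφN hφB Cφ hφC z z' hz' hzz' χ hχ hf'
    Ξ₁ Ξ₂ Ξ₃ Ξ₄ hΞ₁m CΞ₁ hΞ₁C hΞ₁K hΞ₁M hΞ₁ hΞ₂m CΞ₂ hΞ₂C hΞ₂K hΞ₂M hΞ₂ hΞ₃m CΞ₃ hΞ₃C hΞ₃K hΞ₃M hΞ₃ hΞ₄m CΞ₄ hΞ₄C hΞ₄K hΞ₄M hΞ₄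
  -- the auxiliary data of ★ p858035's plug: Borel structures, additive Haar measures, a purely imaginary `δ ≠ 0`, `m = [L⁺:ℚ] + 1`, the two `rfl` side conditions of the line chart
  letI : MeasurableSpace (AdeleRing (𝓞 L) L) := borel _
  haveI : BorelSpace (AdeleRing (𝓞 L) L) := ⟨rfl⟩
  letI : MeasurableSpace (AdeleRing (𝓞 ↥(maximalRealSubfield L)) ↥(maximalRealSubfield L)) := borel _
  haveI : BorelSpace (AdeleRing (𝓞 ↥(maximalRealSubfield L)) ↥(maximalRealSubfield L)) := ⟨rfl⟩
  letI : MeasurableSpace (InfiniteAdeleRing ↥(maximalRealSubfield L)) := borel _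
  haveI : BorelSpace (InfiniteAdeleRing ↥(maximalRealSubfield L)) := ⟨rfl⟩
  letI : MeasurableSpace (FiniteAdeleRing (𝓞 ↥(maximalRealSubfield L)) ↥(maximalRealSubfield L)) := borel _
  haveI : BorelSpace (FiniteAdeleRing (𝓞 ↥(maximalRealSubfield L)) ↥(maximalRealSubfield L)) := ⟨rfl⟩
  haveI := locallyCompactSpace_adeleRing' ↥(maximalRealSubfield L)
  haveI := locallyCompactSpace_finiteAdeleRing' ↥(maximalRealSubfield L)
  obtain ⟨e, he⟩ := Literature.NumberTheory.NumberFields.IsCMField.exists_complexConj_ne L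
  have hcδ : IsCMField.complexConj L (e - IsCMField.complexConj L e) = -(e - IsCMField.complexConj L e) := by
    rw [map_sub, IsCMField.complexConj_apply_apply, neg_sub]
  have hδ : e - IsCMField.complexConj L e ≠ 0 := sub_ne_zero.2 (Ne.symm he)
  have hij : (((0 : Fin 2) : ℕ)) + 1 = ((1 : Fin 2) : ℕ) := rfl
  have hN : 2 = 2 * ((0 : Fin 2) : ℕ) + 2 := rfl
  obtain ⟨M₁, hdec'⟩ := exists_bound_sub_borelConstantTerm_level_cm_two_const L hij hN hcδ hδ ν h𝓕N h𝓕c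
    (Measure.addHaar : Measure (AdeleRing (𝓞 ↥(maximalRealSubfield L)) ↥(maximalRealSubfield L))) (Measure.addHaar : Measure (InfiniteAdeleRing ↥(maximalRealSubfield L)))
    (Measure.addHaar : Measure (FiniteAdeleRing (𝓞 ↥(maximalRealSubfield L)) ↥(maximalRealSubfield L))) χ hχ hz' φ₀' hf' hT
    (m := finrank ℚ ↥(maximalRealSubfield L) + 1) (by push_cast; linarith)
  exact h hβ hT hφc hφN hφB hφC continuous_const (fun _ _ => rfl) (fun _ _ _ => rfl) (fun _ => le_refl ‖φ₀'‖) hz' hzz' hdec'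
    hΞ₁m hΞ₁C hΞ₁K hΞ₁M hΞ₁ hΞ₂m hΞ₂C hΞ₂K hΞ₂M hΞ₂ hΞ₃m hΞ₃C hΞ₃K hΞ₃M hΞ₃ hΞ₄m hΞ₄C hΞ₄K hΞ₄M hΞ₄

/-! ## §3 ED. 2, general finite-level second coefficient: survivors `hf′ U₀ hφ′U hm hφ′arch` and `hΞ₁…hΞ₄` -/

include hij hN in
/-- **ED. 2 WITH A GENERAL FINITE-LEVEL `φ′`**: survivors `χ hχ hf′ U₀ hU₀o hU₀K hφ′U m hm A_φ′ hA_φ′ hφ′arch` (★ p857911 B′ pays `hdec′`; its Haar measures ∕ Borel structures chosen inside) and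
`hΞ₁…hΞ₄` — §1 ∘ B′ (`hij`, `hN` are the two `rfl` side conditions of the line chart `θ`, `δ` its purely imaginary parameter). [cite: MoeglinWaldspurger1995, I.2.10–I.2.13, II.1.7 and IV.2.1–IV.2.3]
[cite: Garrett2018, §2.9–§2.11 and §11.3] -/
theorem maassSelberg_flatSectionU_cm_two_final_of_archSmooth'
    (μ : Measure (quasiSplit (↥(maximalRealSubfield L)) L (IsCMField.complexConj L) 2).automorphicQuotient) [(quasiSplit (↥(maximalRealSubfield L)) L (IsCMField.complexConj L) 2).IsAutomorphicMeasure μ]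
    (νG : Measure (quasiSplit (↥(maximalRealSubfield L)) L (IsCMField.complexConj L) 2).Adelic) [νG.IsHaarMeasure] [νG.IsInvInvariant]
    (μK : Measure ((standardMaximalCompactGL 2 L).comap (adelicVal (↥(maximalRealSubfield L)) L (IsCMField.complexConj L) 2 ((StdForm.antidiagonal 2).over L)) : Subgroup (quasiSplit (↥(maximalRealSubfield L)) L (IsCMField.complexConj L) 2).Adelic))
    [μK.IsHaarMeasure]
    (νI : Measure (AdeleRing (𝓞 L) L)ˣ) [νI.IsHaarMeasure]
    {𝓕I : Set (AdeleRing (𝓞 L) L)ˣ} (h𝓕I : IsIdeleClassDomain L 𝓕I)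
    {δ : L} (hcδ : IsCMField.complexConj L δ = -δ) (hδ : δ ≠ 0)
    (ν : Measure ↥(adelicUnipotent (↥(maximalRealSubfield L)) L (IsCMField.complexConj L) 2)) [ν.IsHaarMeasure]
    {𝓕 : Set ↥(adelicUnipotent (↥(maximalRealSubfield L)) L (IsCMField.complexConj L) 2)} (h𝓕N : IsFundamentalDomain ↥(rationalUnipotent (↥(maximalRealSubfield L)) L (IsCMField.complexConj L) 2) 𝓕 ν) (h𝓕1 : ν 𝓕 = 1)
    (h𝓕c : IsCompact (closure 𝓕)) :
    ∃ cμ K : ℝ, 0 < cμ ∧ 0 < K ∧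
      ∀ {β : (quasiSplit (↥(maximalRealSubfield L)) L (IsCMField.complexConj L) 2).Adelic → ℝ≥0∞}, IsCoveringWeight ((arithmeticBorel (↥(maximalRealSubfield L)) L (IsCMField.complexConj L) 2).map (quasiSplit (↥(maximalRealSubfield L)) L (IsCMField.complexConj L) 2).arithmeticSubgroup.subtype) β →
      ∀ {T : ℝ≥0}, 1 ≤ T →
      ∀ {φ φ' : (quasiSplit (↥(maximalRealSubfield L)) L (IsCMField.complexConj L) 2).Adelic → ℂ},
      Continuous φ →
        (∀ (n : unipotentInBorel (↥(maximalRealSubfield L)) L (IsCMField.complexConj L) 2) (y : (quasiSplit (↥(maximalRealSubfield L)) L (IsCMField.complexConj L) 2).Adelic), φ (((n : borelAdelic (↥(maximalRealSubfield L)) L (IsCMField.complexConj L) 2) : (quasiSplit (↥(maximalRealSubfield L)) L (IsCMField.complexConj L) 2).Adelic) * y) = φ y) →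
        (∀ b ∈ arithmeticBorel (↥(maximalRealSubfield L)) L (IsCMField.complexConj L) 2, ∀ y : (quasiSplit (↥(maximalRealSubfield L)) L (IsCMField.complexConj L) 2).Adelic, φ ((b : (quasiSplit (↥(maximalRealSubfield L)) L (IsCMField.complexConj L) 2).Adelic) * y) = φ y) →
      ∀ {Cφ : ℝ}, (∀ x, ‖φ x‖ ≤ Cφ) →
      Continuous φ' →
        (∀ (n : unipotentInBorel (↥(maximalRealSubfield L)) L (IsCMField.complexConj L) 2) (y : (quasiSplit (↥(maximalRealSubfield L)) L (IsCMField.complexConj L) 2).Adelic), φ' (((n : borelAdelic (↥(maximalRealSubfield L)) L (IsCMField.complexConj L) 2) : (quasiSplit (↥(maximalRealSubfield L)) L (IsCMField.complexConj L) 2).Adelic) * y) = φ' y) →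
        (∀ b ∈ arithmeticBorel (↥(maximalRealSubfield L)) L (IsCMField.complexConj L) 2, ∀ y : (quasiSplit (↥(maximalRealSubfield L)) L (IsCMField.complexConj L) 2).Adelic, φ' ((b : (quasiSplit (↥(maximalRealSubfield L)) L (IsCMField.complexConj L) 2).Adelic) * y) = φ' y) →
      ∀ {Cφ' : ℝ}, (∀ x, ‖φ' x‖ ≤ Cφ') →
      ∀ {z z' : ℂ}, 1 < z'.re → z'.re < z.re →
      -- GENERAL finite-level `φ′`: `hdec′` is ★ p857911 B′ from `χ` unitary, `hf′`, `U₀` open `≤ GL₂(𝒪̂_L)` fixing `φ′`, `m > [L⁺:ℚ]`, `A_φ′ ≥ 0`, `hφ′arch`; then the `K_U`-average data `hΞ₁…hΞ₄`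
        ∀ (χ : GaloisRepresentations.HeckeCharacter L), χ.IsUnitary →
        (∀ (b g : (quasiSplit (↥(maximalRealSubfield L)) L (IsCMField.complexConj L) 2).Adelic) (u : (AdeleRing (𝓞 L) L)ˣ),
          ((b.1 : GL (Fin 2) (AdeleRing (𝓞 L) L)) : Matrix (Fin 2) (Fin 2) (AdeleRing (𝓞 L) L)) 1 0 = 0 →
          (u : (AdeleRing (𝓞 L) L)) = ((b.1 : GL (Fin 2) (AdeleRing (𝓞 L) L)) : Matrix (Fin 2) (Fin 2) (AdeleRing (𝓞 L) L)) 0 0 →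
            flatSectionU φ' z' (b * g) = ((χ u : ℂˣ) : ℂ) * ((GaloisRepresentations.ideleNorm u : ℝ) : ℂ) ^ z' * flatSectionU φ' z' g) →
        ∀ {U₀ : Subgroup (GL (Fin 2) (FiniteAdeleRing (𝓞 L) L))}, IsOpen (U₀ : Set (GL (Fin 2) (FiniteAdeleRing (𝓞 L) L))) → U₀ ≤ glFiniteIntegralLevel 2 L →
        (∀ u : (quasiSplit (↥(maximalRealSubfield L)) L (IsCMField.complexConj L) 2).Adelic, adelicVal ↥(maximalRealSubfield L) L (IsCMField.complexConj L) 2 ((StdForm.antidiagonal 2).over L) u ∈ U₀.map (GLn.ofFinite 2 L) → ∀ y : (quasiSplit (↥(maximalRealSubfield L)) L (IsCMField.complexConj L) 2).Adelic, φ' (y * u) = φ' y) →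
        ∀ {m : ℕ}, (finrank ℚ ↥(maximalRealSubfield L) : ℝ) < m → ∀ {Aφ' : ℝ}, 0 ≤ Aφ' →
        (∀ k ∈ ((standardMaximalCompactGL 2 L).comap (adelicVal ↥(maximalRealSubfield L) L (IsCMField.complexConj L) 2 ((StdForm.antidiagonal 2).over L)) : Subgroup (quasiSplit (↥(maximalRealSubfield L)) L (IsCMField.complexConj L) 2).Adelic), ∀ b : FiniteAdeleRing (𝓞 ↥(maximalRealSubfield L)) ↥(maximalRealSubfield L),
          ContDiff ℝ m ((fun a : InfiniteAdeleRing ↥(maximalRealSubfield L) => flatSectionU φ' z' (((quasiSplit (↥(maximalRealSubfield L)) L (IsCMField.complexConj L) 2).toAdelic (weylLongU ((IsCMField.complexConj L : L ≃ₐ[↥(maximalRealSubfield L)] L) : L →+* L) (rfl : ((StdForm.antidiagonal 2).over L) = ((StdForm.antidiagonal 2).over L)))) *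
              ((middleRootUnipotent hij hN (Multiplicative.ofAdd (traceZeroLine ↥(maximalRealSubfield L) L (IsCMField.complexConj L) hcδ hδ ((a, b) : AdeleRing (𝓞 ↥(maximalRealSubfield L)) ↥(maximalRealSubfield L)))) : ↥(adelicUnipotent ↥(maximalRealSubfield L) L (IsCMField.complexConj L) 2)) : (quasiSplit (↥(maximalRealSubfield L)) L (IsCMField.complexConj L) 2).Adelic) * k)) ∘ (InfiniteAdeleRing.ringEquiv_mixedSpace ↥(maximalRealSubfield L)).symm) ∧
          ∀ j : ℕ, j ≤ m → ∀ s : mixedSpace ↥(maximalRealSubfield L),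
            ‖iteratedFDeriv ℝ j ((fun a : InfiniteAdeleRing ↥(maximalRealSubfield L) => flatSectionU φ' z' (((quasiSplit (↥(maximalRealSubfield L)) L (IsCMField.complexConj L) 2).toAdelic (weylLongU ((IsCMField.complexConj L : L ≃ₐ[↥(maximalRealSubfield L)] L) : L →+* L) (rfl : ((StdForm.antidiagonal 2).over L) = ((StdForm.antidiagonal 2).over L)))) *
              ((middleRootUnipotent hij hN (Multiplicative.ofAdd (traceZeroLine ↥(maximalRealSubfield L) L (IsCMField.complexConj L) hcδ hδ ((a, b) : AdeleRing (𝓞 ↥(maximalRealSubfield L)) ↥(maximalRealSubfield L)))) : ↥(adelicUnipotent ↥(maximalRealSubfield L) L (IsCMField.complexConj L) 2)) : (quasiSplit (↥(maximalRealSubfield L)) L (IsCMField.complexConj L) 2).Adelic) * k)) ∘ (InfiniteAdeleRing.ringEquiv_mixedSpace ↥(maximalRealSubfield L)).symm) s‖ ≤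
              Aφ' * (borelHeight (((quasiSplit (↥(maximalRealSubfield L)) L (IsCMField.complexConj L) 2).toAdelic (weylLongU ((IsCMField.complexConj L : L ≃ₐ[↥(maximalRealSubfield L)] L) : L →+* L) (rfl : ((StdForm.antidiagonal 2).over L) = ((StdForm.antidiagonal 2).over L)))) *
              ((middleRootUnipotent hij hN (Multiplicative.ofAdd (traceZeroLine ↥(maximalRealSubfield L) L (IsCMField.complexConj L) hcδ hδ (((InfiniteAdeleRing.ringEquiv_mixedSpace ↥(maximalRealSubfield L)).symm s, b) : AdeleRing (𝓞 ↥(maximalRealSubfield L)) ↥(maximalRealSubfield L)))) : ↥(adelicUnipotent ↥(maximalRealSubfield L) L (IsCMField.complexConj L) 2)) : (quasiSplit (↥(maximalRealSubfield L)) L (IsCMField.complexConj L) 2).Adelic) * k) : ℝ) ^ z'.re) →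
      ∀ {Ξ₁ Ξ₂ Ξ₃ Ξ₄ : (AdeleRing (𝓞 L) L)ˣ → ℂ},
      Measurable Ξ₁ → ∀ {CΞ₁ : ℝ}, (∀ x, ‖Ξ₁ x‖ ≤ CΞ₁) → (∀ k ∈ GaloisRepresentations.principalIdeles L, ∀ x, Ξ₁ (k * x) = Ξ₁ x) →
        (∀ (r : ℝ≥0ˣ) (x : (AdeleRing (𝓞 L) L)ˣ), Ξ₁ (posRealIdele L r * x) = Ξ₁ x) →
        (∀ t : torusInBorel (↥(maximalRealSubfield L)) L (IsCMField.complexConj L) 2,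
          ∫ k, φ (((t : borelAdelic (↥(maximalRealSubfield L)) L (IsCMField.complexConj L) 2) : (quasiSplit (↥(maximalRealSubfield L)) L (IsCMField.complexConj L) 2).Adelic) * (k : (quasiSplit (↥(maximalRealSubfield L)) L (IsCMField.complexConj L) 2).Adelic)) *
              conj (φ' (((t : borelAdelic (↥(maximalRealSubfield L)) L (IsCMField.complexConj L) 2) : (quasiSplit (↥(maximalRealSubfield L)) L (IsCMField.complexConj L) 2).Adelic) * (k : (quasiSplit (↥(maximalRealSubfield L)) L (IsCMField.complexConj L) 2).Adelic))) ∂μK = Ξ₁ (diagUnit (t : borelAdelic (↥(maximalRealSubfield L)) L (IsCMField.complexConj L) 2).2 0)) →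
      Measurable Ξ₂ → ∀ {CΞ₂ : ℝ}, (∀ x, ‖Ξ₂ x‖ ≤ CΞ₂) → (∀ k ∈ GaloisRepresentations.principalIdeles L, ∀ x, Ξ₂ (k * x) = Ξ₂ x) →
        (∀ (r : ℝ≥0ˣ) (x : (AdeleRing (𝓞 L) L)ˣ), Ξ₂ (posRealIdele L r * x) = Ξ₂ x) →
        (∀ t : torusInBorel (↥(maximalRealSubfield L)) L (IsCMField.complexConj L) 2,
          ∫ k, φ (((t : borelAdelic (↥(maximalRealSubfield L)) L (IsCMField.complexConj L) 2) : (quasiSplit (↥(maximalRealSubfield L)) L (IsCMField.complexConj L) 2).Adelic) * (k : (quasiSplit (↥(maximalRealSubfield L)) L (IsCMField.complexConj L) 2).Adelic)) *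
              conj ((fun g : (quasiSplit (↥(maximalRealSubfield L)) L (IsCMField.complexConj L) 2).Adelic => (∫ v : ↥(adelicUnipotent (↥(maximalRealSubfield L)) L (IsCMField.complexConj L) 2), flatSectionU φ' z' ((quasiSplit (↥(maximalRealSubfield L)) L (IsCMField.complexConj L) 2).toAdelic (weylLongU ((IsCMField.complexConj L : L ≃ₐ[↥(maximalRealSubfield L)] L) : L →+* L) (rfl : (StdForm.antidiagonal 2).over L = (StdForm.antidiagonal 2).over L)) * ((v : (quasiSplit (↥(maximalRealSubfield L)) L (IsCMField.complexConj L) 2).Adelic) * g)) ∂ν) * ((borelHeight g : ℝ) : ℂ) ^ (z' - 1)) (((t : borelAdelic (↥(maximalRealSubfield L)) L (IsCMField.complexConj L) 2) : (quasiSplit (↥(maximalRealSubfield L)) L (IsCMField.complexConj L) 2).Adelic) * (k : (quasiSplit (↥(maximalRealSubfield L)) L (IsCMField.complexConj L) 2).Adelic))) ∂μK = Ξ₂ (diagUnit (t : borelAdelic (↥(maximalRealSubfield L)) L (IsCMField.complexConj L) 2).2 0)) →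
      Measurable Ξ₃ → ∀ {CΞ₃ : ℝ}, (∀ x, ‖Ξ₃ x‖ ≤ CΞ₃) → (∀ k ∈ GaloisRepresentations.principalIdeles L, ∀ x, Ξ₃ (k * x) = Ξ₃ x) →
        (∀ (r : ℝ≥0ˣ) (x : (AdeleRing (𝓞 L) L)ˣ), Ξ₃ (posRealIdele L r * x) = Ξ₃ x) →
        (∀ t : torusInBorel (↥(maximalRealSubfield L)) L (IsCMField.complexConj L) 2,
          ∫ k, (fun g : (quasiSplit (↥(maximalRealSubfield L)) L (IsCMField.complexConj L) 2).Adelic => (∫ v : ↥(adelicUnipotent (↥(maximalRealSubfield L)) L (IsCMField.complexConj L) 2), flatSectionU φ z ((quasiSplit (↥(maximalRealSubfield L)) L (IsCMField.complexConj L) 2).toAdelic (weylLongU ((IsCMField.complexConj L : L ≃ₐ[↥(maximalRealSubfield L)] L) : L →+* L) (rfl : (StdForm.antidiagonal 2).over L = (StdForm.antidiagonal 2).over L)) * ((v : (quasiSplit (↥(maximalRealSubfield L)) L (IsCMField.complexConj L) 2).Adelic) * g)) ∂ν) * ((borelHeight g : ℝ) : ℂ) ^ (z - 1)) (((t : borelAdelic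 (↥(maximalRealSubfield L)) L (IsCMField.complexConj L) 2) : (quasiSplit (↥(maximalRealSubfield L)) L (IsCMField.complexConj L) 2).Adelic) * (k : (quasiSplit (↥(maximalRealSubfield L)) L (IsCMField.complexConj L) 2).Adelic)) *
              conj (φ' (((t : borelAdelic (↥(maximalRealSubfield L)) L (IsCMField.complexConj L) 2) : (quasiSplit (↥(maximalRealSubfield L)) L (IsCMField.complexConj L) 2).Adelic) * (k : (quasiSplit (↥(maximalRealSubfield L)) L (IsCMField.complexConj L) 2).Adelic))) ∂μK = Ξ₃ (diagUnit (t : borelAdelic (↥(maximalRealSubfield L)) L (IsCMField.complexConj L) 2).2 0)) →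
      Measurable Ξ₄ → ∀ {CΞ₄ : ℝ}, (∀ x, ‖Ξ₄ x‖ ≤ CΞ₄) → (∀ k ∈ GaloisRepresentations.principalIdeles L, ∀ x, Ξ₄ (k * x) = Ξ₄ x) →
        (∀ (r : ℝ≥0ˣ) (x : (AdeleRing (𝓞 L) L)ˣ), Ξ₄ (posRealIdele L r * x) = Ξ₄ x) →
        (∀ t : torusInBorel (↥(maximalRealSubfield L)) L (IsCMField.complexConj L) 2,
          ∫ k, (fun g : (quasiSplit (↥(maximalRealSubfield L)) L (IsCMField.complexConj L) 2).Adelic => (∫ v : ↥(adelicUnipotent (↥(maximalRealSubfield L)) L (IsCMField.complexConj L) 2), flatSectionU φ z ((quasiSplit (↥(maximalRealSubfield L)) L (IsCMField.complexConj L) 2).toAdelic (weylLongU ((IsCMField.complexConj L : L ≃ₐ[↥(maximalRealSubfield L)] L) : L →+* L) (rfl : (StdForm.antidiagonal 2).over L = (StdForm.antidiagonal 2).over L)) * ((v : (quasiSplit (↥(maximalRealSubfield L)) L (IsCMField.complexConj L) 2).Adelic) * g)) ∂ν) * ((borelHeight g : ℝ) : ℂ) ^ (z - 1)) (((t : borelAdelic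 (↥(maximalRealSubfield L)) L (IsCMField.complexConj L) 2) : (quasiSplit (↥(maximalRealSubfield L)) L (IsCMField.complexConj L) 2).Adelic) * (k : (quasiSplit (↥(maximalRealSubfield L)) L (IsCMField.complexConj L) 2).Adelic)) *
              conj ((fun g : (quasiSplit (↥(maximalRealSubfield L)) L (IsCMField.complexConj L) 2).Adelic => (∫ v : ↥(adelicUnipotent (↥(maximalRealSubfield L)) L (IsCMField.complexConj L) 2), flatSectionU φ' z' ((quasiSplit (↥(maximalRealSubfield L)) L (IsCMField.complexConj L) 2).toAdelic (weylLongU ((IsCMField.complexConj L : L ≃ₐ[↥(maximalRealSubfield L)] L) : L →+* L) (rfl : (StdForm.antidiagonal 2).over L = (StdForm.antidiagonal 2).over L)) * ((v : (quasiSplit (↥(maximalRealSubfield L)) L (IsCMField.complexConj L) 2).Adelic) * g)) ∂ν) * ((borelHeight g : ℝ) : ℂ) ^ (z' - 1)) (((t : borelAdelic (↥(maximalRealSubfield L)) L (IsCMField.complexConj L) 2) : (quasiSplit (↥(maximalRealSubfield L)) L (IsCMField.complexConj L) 2).Adelic) * (k : (quasiSplit (↥(maximalRealSubfield L)) L (IsCMField.complexConj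 L) 2).Adelic))) ∂μK = Ξ₄ (diagUnit (t : borelAdelic (↥(maximalRealSubfield L)) L (IsCMField.complexConj L) 2).2 0)) →
        ∫ x, (quasiSplit (↥(maximalRealSubfield L)) L (IsCMField.complexConj L) 2).quotFun (truncation ν 𝓕 T (eisensteinSeriesU (flatSectionU φ z))) x * conj ((quasiSplit (↥(maximalRealSubfield L)) L (IsCMField.complexConj L) 2).quotFun (truncation ν 𝓕 T (eisensteinSeriesU (flatSectionU φ' z'))) x) ∂μ =
          (cμ : ℂ) * ((K : ℂ) *
            ((((T : ℝ) : ℂ) ^ (z + conj z' - 1) / (z + conj z' - 1)) * (∫ x in {x : (AdeleRing (𝓞 L) L)ˣ | (IdeleClassGroup.ideleNorm L x : ℝ) ≤ 1} ∩ 𝓕I, ((IdeleClassGroup.ideleNorm L x : ℝ) : ℂ) * Ξ₁ x ∂νI)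
              + (((T : ℝ) : ℂ) ^ (z - conj z') / (z - conj z')) * (∫ x in {x : (AdeleRing (𝓞 L) L)ˣ | (IdeleClassGroup.ideleNorm L x : ℝ) ≤ 1} ∩ 𝓕I, ((IdeleClassGroup.ideleNorm L x : ℝ) : ℂ) * Ξ₂ x ∂νI)
              - (((T : ℝ) : ℂ) ^ (-(z - conj z')) / (z - conj z')) * (∫ x in {x : (AdeleRing (𝓞 L) L)ˣ | (IdeleClassGroup.ideleNorm L x : ℝ) ≤ 1} ∩ 𝓕I, ((IdeleClassGroup.ideleNorm L x : ℝ) : ℂ) * Ξ₃ x ∂νI)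
              - (((T : ℝ) : ℂ) ^ (-(z + conj z' - 1)) / (z + conj z' - 1)) * (∫ x in {x : (AdeleRing (𝓞 L) L)ˣ | (IdeleClassGroup.ideleNorm L x : ℝ) ≤ 1} ∩ 𝓕I, ((IdeleClassGroup.ideleNorm L x : ℝ) : ℂ) * Ξ₄ x ∂νI))) := by
  obtain ⟨cμ, K, hcμ, hK, h⟩ := maassSelberg_flatSectionU_cm_two_final' L μ νG μK νI h𝓕I ν h𝓕N h𝓕1 h𝓕c
  refine ⟨cμ, K, hcμ, hK, ?_⟩
  intro β hβ T hT φ φ' hφc hφN hφB Cφ hφC hφ'c hφ'N hφ'B Cφ' hφ'C z z' hz' hzz' χ hχ hf' U₀ hU₀o hU₀K hφ'U m hm Aφ' hAφ' hφ'arch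
    Ξ₁ Ξ₂ Ξ₃ Ξ₄ hΞ₁m CΞ₁ hΞ₁C hΞ₁K hΞ₁M hΞ₁ hΞ₂m CΞ₂ hΞ₂C hΞ₂K hΞ₂M hΞ₂ hΞ₃m CΞ₃ hΞ₃C hΞ₃K hΞ₃M hΞ₃ hΞ₄m CΞ₄ hΞ₄C hΞ₄K hΞ₄M hΞ₄
  -- B′'s auxiliary data: Borel structures and additive Haar measures of `𝔸_L`, `𝔸_{L⁺}`, `𝔸_{L⁺,∞}`, `𝔸_{L⁺,f}` (not in the statement)
  letI : MeasurableSpace (AdeleRing (𝓞 L) L) := borel _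
  haveI : BorelSpace (AdeleRing (𝓞 L) L) := ⟨rfl⟩
  letI : MeasurableSpace (AdeleRing (𝓞 ↥(maximalRealSubfield L)) ↥(maximalRealSubfield L)) := borel _
  haveI : BorelSpace (AdeleRing (𝓞 ↥(maximalRealSubfield L)) ↥(maximalRealSubfield L)) := ⟨rfl⟩
  letI : MeasurableSpace (InfiniteAdeleRing ↥(maximalRealSubfield L)) := borel _
  haveI : BorelSpace (InfiniteAdeleRing ↥(maximalRealSubfield L)) := ⟨rfl⟩
  letI : MeasurableSpace (FiniteAdeleRing (𝓞 ↥(maximalRealSubfield L)) ↥(maximalRealSubfield L)) := borel _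
  haveI : BorelSpace (FiniteAdeleRing (𝓞 ↥(maximalRealSubfield L)) ↥(maximalRealSubfield L)) := ⟨rfl⟩
  haveI := locallyCompactSpace_adeleRing' ↥(maximalRealSubfield L)
  haveI := locallyCompactSpace_finiteAdeleRing' ↥(maximalRealSubfield L)
  obtain ⟨M₁, hdec'⟩ := exists_bound_sub_borelConstantTerm_level_cm_two_of_archSmooth L hij hN hcδ hδ ν h𝓕N h𝓕c
    (Measure.addHaar : Measure (AdeleRing (𝓞 ↥(maximalRealSubfield L)) ↥(maximalRealSubfield L))) (Measure.addHaar : Measure (InfiniteAdeleRing ↥(maximalRealSubfield L)))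
    (Measure.addHaar : Measure (FiniteAdeleRing (𝓞 ↥(maximalRealSubfield L)) ↥(maximalRealSubfield L))) χ hχ hz' hφ'c hφ'C (forall_arithmeticBorel_iff.1 hφ'B) hf'
    hU₀o hU₀K hφ'U hT hm hAφ' hφ'arch
  exact h hβ hT hφc hφN hφB hφC hφ'c hφ'N hφ'B hφ'C hz' hzz' hdec'
    hΞ₁m hΞ₁C hΞ₁K hΞ₁M hΞ₁ hΞ₂m hΞ₂C hΞ₂K hΞ₂M hΞ₂ hΞ₃m hΞ₃C hΞ₃K hΞ₃M hΞ₃ hΞ₄m hΞ₄C hΞ₄K hΞ₄M hΞ₄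

end Summit.HodgeConjecture.HodgeConjecture.Cruxes.H413.K2E1MaassSelbergCMTwoFinalPair

end
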